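import Literature.Combinatorics.Sahi2008.Functional
import HarnessLib

/-!
# Sahi (2008), eqs. (4)–(7): `E_n` as the signed sum over set partitions — for every `n`

Topic `Literature/Combinatorics/Sahi2008` (companion of `Functional.lean`, which DEFINES the tree's `sahiE μ n f`
by the Lieb–Sahi recursion [LiebSahi2021, Prop. 3.3] and verifies the printed closed forms only for `n ≤ 4`;
its module docstring records "TODO(general form): the set-partition / cycle-sum presentations for general `n`
are not formalised").  This file removes that TODO: the recursion and Sahi's ORIGINAL definition agree for
every `n ≥ 1`.

## Source (read 2026-08-19 from the author's reprint, corpus `paper:url-5f6060b183b5`, journal p. 211)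

S. Sahi, *Higher correlation inequalities*, Combinatorica **28** (2008) 209–227 [Sahi2008], p. 211:

> "given functions `f_1,…,f_n` in `R[X]`, and a subset `τ` of `{1,…,n}`, we define the corresponding
> correlation to be (4) `E_τ = E_τ(f_1,…,f_n) = E(Π_{i∈τ} f_i) := Σ_{S⊆X} μ(S) Π_{i∈τ} f_i(S)`.  Next, given a
> partition `π` of `{1,…,n}` into disjoint subsets `π = π_1 ∪ ⋯ ∪ π_l` we define the correlation product
> `E_π = Π_{i=1}^{l} E_{π_i}`. … for a given partition `λ` of `n`, we define (5) `E_λ = Σ_{π : λ(π) = λ} E_π`.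
> For each partition `λ` of `n`, we introduce the coefficients (6) `c_λ = (−1)^{l(λ)−1} Π_{i=1}^{l(λ)} (λ_i − 1)!`
> where, as usual, `l(λ)` denotes the number of parts of `λ`.  Finally, we define
> (7) `E_n = E_n(f_1,…,f_n) = Σ_{λ ⊢ n} c_λ E_λ`."

and p. 213: "`E_3 = 2E_(3) − E_(2,1) + E_(1,1,1)`, `E_4 = 6E_(4) − 2E_(3,1) − E_(2,2) + E_(2,1,1) − E_(1,1,1,1)`,
`E_5 = 24E_(5) − 6E_(4,1) − 2E_(3,2) + 2E_(3,1,1) + E_(2,2,1) − E_(2,1,1,1) + E_(1,1,1,1,1)`."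
The same functional in cycle form: [LiebSahi2021, Def. 3.1] `E_n = Σ_{σ∈S_n} (−1)^{C_σ−1} E_σ` (each set
partition with blocks of sizes `λ_1,…,λ_l` is the cycle partition of exactly `Π (λ_i − 1)!` permutations); the
recursion [LiebSahi2021, Prop. 3.3] `E_n(f^1,…,f^{n−1},f) = Σ_{i<n} E_{n−1}(f^1,…,f^i f,…,f^{n−1})
− E_{n−1}(f^1,…,f^{n−1})·E(f)` is derived there from the cycle form by removing `n` from its cycle.

## What is formalised

* `sahiESetPartition μ n f` — Sahi's (4)–(7) verbatim, with (5) and (7) combined into one sum over SET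
  partitions `π` of `{0,…,n−1}` weighted by `c_{λ(π)}`:
  `Σ_π (−1)^{l(π)−1} Π_{B∈π} (|B| − 1)!·E(Π_{i∈B} f_i)`.  The set partitions of `Fin n` are taken as Mathlib's
  `OrderedFinpartition n` (each set partition in its canonical order — blocks listed by increasing largest
  element, each block increasingly — so this is a sum over set partitions, once each).
* **`sahiE_eq_sahiESetPartition`**: for every `n ≥ 1`, every finite type, every weight `μ` and every family `f`,
  the tree's recursively defined `sahiE μ n f` EQUALS `sahiESetPartition μ n f`.  (At `n = 0` the tree's junk
  value `E_0 := 0` differs from the empty-partition value `1`; `E_0` is never used.)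
* Proof = the set-partition version of Lieb–Sahi's proof of Prop. 3.3, run backwards along Mathlib's
  `OrderedFinpartition.extendEquiv` (a set partition of `{0,…,n}` is a set partition of `{1,…,n}` with the new
  point `0` either added as a singleton block — giving the term `−E_{n−1}(tail)·E(f_0)`, sign flip, factor
  `0! = 1` — or inserted into one of its blocks `B`, multiplying the factor `(|B|−1)!` by `|B|`, which is the
  number of slots `i ∈ B` whose function absorbs `f_0` in the recursion): `term_extendLeft`,
  `sum_term_extendMiddle`.

Everything here is PROVED; no named facts; axioms standard.  Motivation (this programme, crux
`stmt-CriticalPhenomena-4575`, cells prim-sahi / prim-master-conj): the cell's exhaustive censuses of `E_k`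
(CENSUS.md; engines `sahicomb`, `rcomb`, `e4/e5`) and the master-family file `Summits/…/SahiMasterFamily.lean`
evaluate `E_k` by the set-partition formula; this file makes "set-partition formula = tree `sahiE`" a theorem
for every `k` instead of a check for `k ≤ 4`.
-/

noncomputable section

namespace Literature.Combinatorics.Sahi2008

open Finset Function

variable {α : Type*} [Fintype α]

/-! ### Blocks of a set partition of `Fin n` (Mathlib's `OrderedFinpartition`) -/

namespace PartitionForm

variable {n : ℕ}

/-- The block of the set partition `c` with label `m`, as a finite subset of `Fin n` (the fibre of
`c.index`; = the range of the increasing enumeration `c.emb m`). [cite: Sahi2008, p. 211 (the blocks `π_i` of `π`)] -/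
def block (c : OrderedFinpartition n) (m : Fin c.length) : Finset (Fin n) :=
  univ.filter fun x => c.index x = m

/-- `c.index x = m` iff `x` lies in the range of the enumeration of block `m`. [folklore] -/
private theorem index_eq_iff (c : OrderedFinpartition n) {x : Fin n} {m : Fin c.length} :
    c.index x = m ↔ x ∈ Set.range (c.emb m) := by
  constructor
  · rintro rfl
    exact ⟨c.invEmbedding x, c.emb_invEmbedding x⟩
  · rintro ⟨r, rfl⟩
    by_contra h
    exact c.emb_ne_emb_of_ne h (c.emb_invEmbedding (c.emb m r))

/-- Membership in a block. [cite: Sahi2008, p. 211 (the blocks `π_i` of `π`)] -/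
theorem mem_block {c : OrderedFinpartition n} {m : Fin c.length} {x : Fin n} :
    x ∈ block c m ↔ x ∈ Set.range (c.emb m) := by
  rw [block, mem_filter, index_eq_iff]
  simp

/-- Each point lies in the block of its index. [folklore] -/
private theorem mem_block_index (c : OrderedFinpartition n) (x : Fin n) : x ∈ block c (c.index x) := by
  rw [block, mem_filter]
  exact ⟨mem_univ _, rfl⟩

/-- A block is the image of its enumeration. [folklore] -/
private theorem block_eq_image (c : OrderedFinpartition n) (m : Fin c.length) :
    block c m = univ.image (c.emb m) := by
  ext x
  rw [mem_block, mem_image, Set.mem_range]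
  simp

/-- `|π_m| = partSize m`. [cite: Sahi2008, p. 211 (the cardinalities `|π_i|`)] -/
theorem card_block (c : OrderedFinpartition n) (m : Fin c.length) : (block c m).card = c.partSize m := by
  rw [block_eq_image, card_image_of_injective _ (c.emb_strictMono m).injective, card_univ, Fintype.card_fin]

/-- A product over a block is the product over its enumeration. [folklore] -/
private theorem prod_block_eq {M : Type*} [CommMonoid M] (c : OrderedFinpartition n) (m : Fin c.length)
    (g : Fin n → M) : ∏ x ∈ block c m, g x = ∏ r : Fin (c.partSize m), g (c.emb m r) := by
  rw [block_eq_image, prod_image fun a _ b _ h => (c.emb_strictMono m).injective h]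

/-! ### Blocks of the extended partitions (the new point `0` as a singleton / inserted into block `k`) -/

/-- Adding `0` as a new singleton block: the new block `0` is `{0}`. [cite: LiebSahi2021, Prop. 3.3 (proof: "(n) occurs as a separate cycle")] -/
theorem block_extendLeft_zero (c : OrderedFinpartition n) :
    block c.extendLeft (0 : Fin (c.length + 1)) = {0} := by
  ext x
  rw [mem_block, mem_singleton]
  constructor
  · rintro ⟨r, rfl⟩
    simp [OrderedFinpartition.extendLeft]
  · rintro rfl
    refine ⟨Fin.cast (by simp [OrderedFinpartition.extendLeft]) (0 : Fin 1), ?_⟩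
    simp [OrderedFinpartition.extendLeft]

/-- Adding `0` as a new singleton block: the old blocks are shifted by `succ`. [cite: LiebSahi2021, Prop. 3.3 (proof)] -/
theorem block_extendLeft_succ (c : OrderedFinpartition n) (m : Fin c.length) :
    block c.extendLeft (Fin.succ m) = (block c m).map (Fin.succEmb n) := by
  ext x
  rw [mem_block, mem_map]
  constructor
  · rintro ⟨r, hr⟩
    refine ⟨c.emb m r, mem_block.2 ⟨r, rfl⟩, ?_⟩
    rw [← hr]
    simp [OrderedFinpartition.extendLeft]
  · rintro ⟨y, hy, rfl⟩
    obtain ⟨r, rfl⟩ := mem_block.1 hy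
    refine ⟨r, ?_⟩
    simp [OrderedFinpartition.extendLeft]

/-- Inserting `0` into block `k`: the new block `k` is `{0} ∪ succ(old block k)`. [cite: LiebSahi2021, Prop. 3.3 (proof: "i and n occur in the same cycle")] -/
theorem block_extendMiddle_self (c : OrderedFinpartition n) (k : Fin c.length) :
    block (c.extendMiddle k) k = insert 0 ((block c k).map (Fin.succEmb n)) := by
  ext x
  rw [mem_block, mem_insert, mem_map]
  have hsize : (c.extendMiddle k).partSize k = c.partSize k + 1 := by
    simp [OrderedFinpartition.extendMiddle]
  constructor
  · rintro ⟨r, hr⟩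
    obtain ⟨r', rfl⟩ : ∃ r' : Fin (c.partSize k + 1), r = Fin.cast hsize.symm r' :=
      ⟨Fin.cast hsize r, by simp⟩
    revert hr
    refine Fin.cases ?_ (fun r'' => ?_) r'
    · intro hr
      left
      rw [← hr]
      simp [OrderedFinpartition.extendMiddle]
    · intro hr
      right
      refine ⟨c.emb k r'', mem_block.2 ⟨_, rfl⟩, ?_⟩
      rw [← hr]
      simp [OrderedFinpartition.extendMiddle]
  · rintro (rfl | ⟨y, hy, rfl⟩)
    · refine ⟨Fin.cast hsize.symm 0, ?_⟩
      simp [OrderedFinpartition.extendMiddle]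
    · obtain ⟨r, rfl⟩ := mem_block.1 hy
      refine ⟨Fin.cast hsize.symm (Fin.succ r), ?_⟩
      simp [OrderedFinpartition.extendMiddle]

/-- Inserting `0` into block `k`: the other blocks are shifted by `succ`. [cite: LiebSahi2021, Prop. 3.3 (proof)] -/
theorem block_extendMiddle_ne (c : OrderedFinpartition n) (k : Fin c.length) {m : Fin c.length} (hm : m ≠ k) :
    block (c.extendMiddle k) m = (block c m).map (Fin.succEmb n) := by
  ext x
  rw [mem_block, mem_map]
  have hsize : (c.extendMiddle k).partSize m = c.partSize m := by
    simp [OrderedFinpartition.extendMiddle, hm]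
  constructor
  · rintro ⟨r, hr⟩
    refine ⟨c.emb m (Fin.cast hsize r), mem_block.2 ⟨_, rfl⟩, ?_⟩
    rw [← hr]
    simp [OrderedFinpartition.extendMiddle, hm]
  · rintro ⟨y, hy, rfl⟩
    obtain ⟨r, rfl⟩ := mem_block.1 hy
    refine ⟨Fin.cast hsize.symm r, ?_⟩
    simp [OrderedFinpartition.extendMiddle, hm]

/-! ### The summand of (7) for one set partition -/

/-- The factor of block `m` in `c_{λ(π)} E_π`: `(|π_m| − 1)!·E(Π_{i∈π_m} f_i)`. [cite: Sahi2008, eqs. (4)–(6) (p. 211)] -/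
def factor (μ : α → ℝ) (f : Fin n → α → ℝ) (c : OrderedFinpartition n) (m : Fin c.length) : ℝ :=
  ((c.partSize m - 1).factorial : ℝ) * ex μ (∏ x ∈ block c m, f x)

/-- The summand `c_{λ(π)} E_π = (−1)^{l−1} Π_m (|π_m| − 1)!·E(Π_{i∈π_m} f_i)` of (7) for the set partition `π = c`.
[cite: Sahi2008, eqs. (4)–(7) (p. 211)] -/
def term (μ : α → ℝ) (f : Fin n → α → ℝ) (c : OrderedFinpartition n) : ℝ :=
  (-1 : ℝ) ^ (c.length - 1) * ∏ m : Fin c.length, factor μ f c m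

/-! ### The new point as a singleton block -/

/-- **Singleton block**: `c_{λ} E_π` for `π = {0} ∪ (c+1)` is `−E(f_0)·(c_{λ(c)} E_c)(tail f)` — the term `−e_n`
of the recursion. [cite: LiebSahi2021, Prop. 3.3 (proof: "C_σ = C_{σ̄} + 1, E_σ = E_{σ̄}·E(f)")] -/
theorem term_extendLeft (μ : α → ℝ) (F : Fin (n + 2) → α → ℝ) (c : OrderedFinpartition (n + 1)) :
    term μ F c.extendLeft = -(ex μ (F 0) * term μ (Fin.tail F) c) := by
  obtain ⟨l, hl⟩ : ∃ l, c.length = l + 1 :=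
    Nat.exists_eq_add_one.2 (c.length_pos (Nat.succ_pos n))
  unfold term
  -- the product over the `c.length + 1` blocks of the extended partition
  have hprod : ∏ m : Fin c.extendLeft.length, factor μ F c.extendLeft m =
      ex μ (F 0) * ∏ m : Fin c.length, factor μ (Fin.tail F) c m := by
    show ∏ m : Fin (c.length + 1), factor μ F c.extendLeft m = _
    rw [Fin.prod_univ_succ]
    congr 1
    · unfold factor
      rw [block_extendLeft_zero, prod_singleton]
      simp [OrderedFinpartition.extendLeft]
    · refine prod_congr rfl fun m _ => ?_
      unfold factor
      rw [block_extendLeft_succ, prod_map]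
      simp only [OrderedFinpartition.extendLeft_partSize, Fin.cons_succ, Fin.coe_succEmb]
      rfl
  rw [hprod]
  have hsign : (-1 : ℝ) ^ (c.extendLeft.length - 1) = -((-1 : ℝ) ^ (c.length - 1)) := by
    have hlen : c.extendLeft.length = c.length + 1 := rfl
    rw [hlen, hl, Nat.add_sub_cancel, Nat.add_sub_cancel, pow_succ]
    ring
  rw [hsign]
  ring

/-! ### The new point inserted into a block -/

/-- The product over the blocks splits off block `k` (plumbing). [folklore] -/
private theorem prod_eq_mul_prod_erase {M : Type*} [CommMonoid M] {l : ℕ} (k : Fin l) (g : Fin l → M) :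
    ∏ m, g m = g k * ∏ m ∈ univ.erase k, g m :=
  (mul_prod_erase univ g (mem_univ k)).symm

/-- **Inserting `0` into block `k`**: the factor of block `k` becomes `|π_k|·(|π_k|−1)!·E(f_0 Π_{i∈π_k} f_{i+1})`
and the other factors are those of `c` for `tail f`. [cite: LiebSahi2021, Prop. 3.3 (proof: "C_σ = C_{σ̄}, E_σ(…,f) = E_{σ̄}(…, fⁱf, …)")] -/
theorem term_extendMiddle (μ : α → ℝ) (F : Fin (n + 2) → α → ℝ) (c : OrderedFinpartition (n + 1))
    (k : Fin c.length) :
    term μ F (c.extendMiddle k) =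
      (-1 : ℝ) ^ (c.length - 1) *
        ((c.partSize k : ℝ) * (((c.partSize k - 1).factorial : ℝ) *
            ex μ (F 0 * ∏ x ∈ block c k, Fin.tail F x)) *
          ∏ m ∈ univ.erase k, factor μ (Fin.tail F) c m) := by
  unfold term
  show (-1 : ℝ) ^ (c.length - 1) * ∏ m : Fin c.length, factor μ F (c.extendMiddle k) m = _
  congr 1
  rw [prod_eq_mul_prod_erase k]
  congr 1
  · -- block `k`: size `|π_k| + 1`, product picks up `F 0`
    unfold factor
    rw [block_extendMiddle_self, prod_insert (by simp), prod_map]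
    simp only [OrderedFinpartition.extendMiddle_partSize, update_self, Nat.add_sub_cancel, Fin.coe_succEmb]
    rw [← Nat.mul_factorial_pred (c.partSize_pos k).ne', Nat.cast_mul, mul_assoc]
    rfl
  · refine prod_congr rfl fun m hm => ?_
    have hmk : m ≠ k := ne_of_mem_erase hm
    unfold factor
    rw [block_extendMiddle_ne c k hmk, prod_map]
    simp only [OrderedFinpartition.extendMiddle_partSize, update_of_ne hmk, Fin.coe_succEmb]
    rfl

/-- The factors of `c` for the family with slot `i` multiplied by `F 0`: only the block containing `i` changes,
and there the moment becomes `E(F_0 · Π_{block} tail F)`. [cite: LiebSahi2021, Prop. 3.3 (proof)] -/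
theorem factor_update (μ : α → ℝ) (F : Fin (n + 2) → α → ℝ) (c : OrderedFinpartition (n + 1))
    (i : Fin (n + 1)) (m : Fin c.length) :
    factor μ (update (Fin.tail F) i (Fin.tail F i * F 0)) c m =
      if c.index i = m then ((c.partSize m - 1).factorial : ℝ) * ex μ (F 0 * ∏ x ∈ block c m, Fin.tail F x)
      else factor μ (Fin.tail F) c m := by
  unfold factor
  split_ifs with h
  · have hi : i ∈ block c m := by rw [← h]; exact mem_block_index c i
    rw [prod_update_of_mem hi, sdiff_singleton_eq_erase, mul_comm (Fin.tail F i) (F 0), mul_assoc,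
      mul_prod_erase _ (Fin.tail F) hi]
  · have hi : i ∉ block c m := by
      rw [block, mem_filter]
      exact fun h' => h h'.2
    rw [prod_update_of_notMem hi]

/-- **The sum over "insert `0` into a block" equals the sum `Σ_i e_i` of the recursion** (for one set partition
`c` of `{1,…,n}`): `Σ_k c_λ E_{c with 0 in block k}(F) = Σ_i c_{λ(c)} E_c(tail F with slot i absorbing F_0)` —
each block `π_k` arises from the `|π_k|` slots `i ∈ π_k`. [cite: LiebSahi2021, Prop. 3.3 (proof: the bijections S⁽ⁱ⁾ → S_{n−1})] -/
theorem sum_term_extendMiddle (μ : α → ℝ) (F : Fin (n + 2) → α → ℝ) (c : OrderedFinpartition (n + 1)) :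
    ∑ k : Fin c.length, term μ F (c.extendMiddle k) =
      ∑ i : Fin (n + 1), term μ (update (Fin.tail F) i (Fin.tail F i * F 0)) c := by
  -- right-hand side: group the slots `i` by the block containing them
  have hR : ∀ i : Fin (n + 1), term μ (update (Fin.tail F) i (Fin.tail F i * F 0)) c =
      (-1 : ℝ) ^ (c.length - 1) *
        ((((c.partSize (c.index i) - 1).factorial : ℝ) *
            ex μ (F 0 * ∏ x ∈ block c (c.index i), Fin.tail F x)) *
          ∏ m ∈ univ.erase (c.index i), factor μ (Fin.tail F) c m) := by
    intro i
    unfold term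
    congr 1
    rw [prod_eq_mul_prod_erase (c.index i)]
    congr 1
    · rw [factor_update, if_pos rfl]
    · refine prod_congr rfl fun m hm => ?_
      rw [factor_update, if_neg (Ne.symm (ne_of_mem_erase hm))]
  simp_rw [hR, term_extendMiddle]
  rw [← mul_sum, ← mul_sum]
  congr 1
  -- `Σ_i g(index i) = Σ_k |π_k| · g(k)`
  rw [← sum_fiberwise' univ c.index (fun k : Fin c.length =>
    (((c.partSize k - 1).factorial : ℝ) * ex μ (F 0 * ∏ x ∈ block c k, Fin.tail F x)) *
      ∏ m ∈ univ.erase k, factor μ (Fin.tail F) c m)]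
  refine sum_congr rfl fun k _ => ?_
  rw [sum_const]
  have hcard : (univ.filter fun i : Fin (n + 1) => c.index i = k).card = c.partSize k := card_block c k
  rw [hcard, nsmul_eq_mul]
  ring

end PartitionForm

open PartitionForm

/-! ### Sahi's definition (7) and the theorem -/

/-- **Sahi's original definition of `E_n`** [Sahi2008, eqs. (4)–(7)]: with `E_τ = E(Π_{i∈τ} f_i)` (4), the
correlation product `E_π = Π_i E_{π_i}` of a set partition `π = π_1 ∪ ⋯ ∪ π_l` of `{1,…,n}`, and
`c_λ = (−1)^{l(λ)−1} Π_i (λ_i − 1)!` (6),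
`E_n(f_1,…,f_n) = Σ_{λ ⊢ n} c_λ E_λ = Σ_{π} (−1)^{l(π)−1} Π_{i=1}^{l(π)} (|π_i| − 1)!·E(Π_{j∈π_i} f_j)`
((5) and (7) combined: `c_λ` only depends on the block sizes).  The set partitions of `Fin n` are Mathlib's
`OrderedFinpartition n` (each set partition exactly once, in canonical order), block `m` being enumerated by
`c.emb m : Fin (c.partSize m) → Fin n`.  Equivalently [LiebSahi2021, Def. 3.1] `Σ_{σ∈S_n} (−1)^{C_σ−1} E_σ`.
[cite: Sahi2008, eqs. (4)–(7) (p. 211); LiebSahi2021, Def. 3.1] -/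
def sahiESetPartition (μ : α → ℝ) (n : ℕ) (f : Fin n → α → ℝ) : ℝ :=
  ∑ c : OrderedFinpartition n,
    (-1 : ℝ) ^ (c.length - 1) *
      ∏ m : Fin c.length, (((c.partSize m - 1).factorial : ℝ) * ex μ (∏ r : Fin (c.partSize m), f (c.emb m r)))

/-- `sahiESetPartition` is the sum of the block-form summands `term`. [cite: Sahi2008, eqs. (4)–(7) (p. 211)] -/
theorem sahiESetPartition_eq_sum_term (μ : α → ℝ) (n : ℕ) (f : Fin n → α → ℝ) :
    sahiESetPartition μ n f = ∑ c : OrderedFinpartition n, term μ f c := by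
  unfold sahiESetPartition term factor
  refine sum_congr rfl fun c _ => ?_
  congr 1
  refine prod_congr rfl fun m _ => ?_
  rw [prod_block_eq]

/-- `E_1`: the only set partition of `{1}` gives `E(f)`. [cite: Sahi2008, eqs. (4)–(7) (p. 211)] -/
theorem sum_term_one (μ : α → ℝ) (f : Fin 1 → α → ℝ) :
    ∑ c : OrderedFinpartition 1, term μ f c = ex μ (f 0) := by
  rw [Fintype.sum_unique, OrderedFinpartition.default_eq]
  unfold term
  have hlen : (OrderedFinpartition.atomic 1).length = 1 := rfl
  have hprod : ∏ m : Fin (OrderedFinpartition.atomic 1).length, factor μ f (OrderedFinpartition.atomic 1) m =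
      factor μ f (OrderedFinpartition.atomic 1) ⟨0, by rw [hlen]; exact Nat.zero_lt_one⟩ := by
    haveI : Subsingleton (Fin (OrderedFinpartition.atomic 1).length) := by rw [hlen]; infer_instance
    exact Fintype.prod_subsingleton _ _
  have hsign : (-1 : ℝ) ^ ((OrderedFinpartition.atomic 1).length - 1) = 1 := by rw [hlen]; norm_num
  rw [hprod, hsign, one_mul]
  unfold factor
  have hblock : block (OrderedFinpartition.atomic 1) ⟨0, by rw [hlen]; exact Nat.zero_lt_one⟩ = univ := by
    apply eq_univ_of_card
    rw [card_block, Fintype.card_fin]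
    rfl
  rw [hblock, Fin.prod_univ_one]
  simp [OrderedFinpartition.atomic]

/-- **The Lieb–Sahi recursion from the set-partition sum** (one step): splitting the set partitions of
`{0,…,n+1}` according to the block of `0` (Mathlib's `OrderedFinpartition.extendEquiv`),
`Σ_{π'} c E_{π'}(F) = Σ_i Σ_π c E_π(tail F, slot i absorbing F_0) − (Σ_π c E_π(tail F))·E(F_0)`.
[cite: LiebSahi2021, Prop. 3.3 (proof)] -/
theorem sum_term_succ (μ : α → ℝ) (n : ℕ) (F : Fin (n + 2) → α → ℝ) :
    ∑ c' : OrderedFinpartition (n + 2), term μ F c' =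
      (∑ i : Fin (n + 1), ∑ c : OrderedFinpartition (n + 1), term μ (update (Fin.tail F) i (Fin.tail F i * F 0)) c) -
        (∑ c : OrderedFinpartition (n + 1), term μ (Fin.tail F) c) * ex μ (F 0) := by
  rw [← Fintype.sum_equiv (OrderedFinpartition.extendEquiv (n + 1)) (fun p => term μ F (p.1.extend p.2))
    (fun c' => term μ F c') (fun p => rfl), Fintype.sum_sigma]
  simp_rw [Fintype.sum_option, OrderedFinpartition.extend_none, OrderedFinpartition.extend_some, term_extendLeft,
    sum_term_extendMiddle]
  rw [sum_add_distrib, sum_comm, sum_neg_distrib, ← mul_sum]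
  ring

/-- **Sahi's definition (7) = the tree's `E_n`, for every `n ≥ 1`.**  The recursively defined
`sahiE μ (n+1) f` (Lieb–Sahi recursion, `Functional.lean`) equals Sahi's signed sum over set partitions
`Σ_π (−1)^{l(π)−1} Π_i (|π_i| − 1)!·E(Π_{j∈π_i} f_j)`, on every finite type, for every weight `μ` and every
family `f` (no positivity, monotonicity or normalisation needed).  In particular the printed `E_3, E_4, E_5`
(p. 213) and every `E_n` computed from (7) are the tree's `sahiE`. [cite: Sahi2008, eqs. (4)–(7) (p. 211); LiebSahi2021, Def. 3.1 and Prop. 3.3] -/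
theorem sahiE_eq_sahiESetPartition (μ : α → ℝ) :
    ∀ (n : ℕ) (f : Fin (n + 1) → α → ℝ), sahiE μ (n + 1) f = sahiESetPartition μ (n + 1) f
  | 0, f => by rw [sahiESetPartition_eq_sum_term, sum_term_one, sahiE_one_apply]
  | n + 1, f => by
    rw [sahiESetPartition_eq_sum_term, sum_term_succ, sahiE_succ_succ]
    have htail := sahiE_eq_sahiESetPartition μ n (Fin.tail f)
    rw [sahiESetPartition_eq_sum_term] at htail
    rw [htail]
    congr 1
    refine sum_congr rfl fun i _ => ?_
    have h := sahiE_eq_sahiESetPartition μ n (update (Fin.tail f) i (Fin.tail f i * f 0))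
    rw [sahiESetPartition_eq_sum_term] at h
    exact h

/-- The junk value at `n = 0`: the tree's `E_0 = 0`, while the empty set partition gives `1` in (7)
(recorded so that no one relies on the `n = 0` case). [cite: Sahi2008, eqs. (4)–(7) (p. 211)] -/
theorem sahiESetPartition_zero (μ : α → ℝ) (f : Fin 0 → α → ℝ) :
    sahiESetPartition μ 0 f = 1 ∧ sahiE μ 0 f = 0 := by
  refine ⟨?_, sahiE_zero μ f⟩
  unfold sahiESetPartition
  rw [Fintype.sum_unique]
  have hlen : (default : OrderedFinpartition 0).length = 0 :=
    Nat.eq_zero_of_le_zero (default : OrderedFinpartition 0).length_le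
  haveI : IsEmpty (Fin (default : OrderedFinpartition 0).length) := by rw [hlen]; infer_instance
  have hsign : (-1 : ℝ) ^ ((default : OrderedFinpartition 0).length - 1) = 1 := by rw [hlen]; norm_num
  rw [hsign, Fintype.prod_empty, mul_one]

/-! ### The printed `E_5` -/

set_option maxHeartbeats 4000000 in
/-- **Sahi's printed `E_5`** (p. 213): `E_5 = 24E_(5) − 6E_(4,1) − 2E_(3,2) + 2E_(3,1,1) + E_(2,2,1) − E_(2,1,1,1)
+ E_(1,1,1,1,1)` — the 52 set partitions of `{1,…,5}` grouped by type, i.e. (7) at `n = 5` written out; equal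
to Richards' fifth conjugate cumulant `κ′_5` [Richards2004, eq. (1.9)] ("for `n = 3, 4, 5` these functionals were
first introduced in [Richards]").  Verified here for the tree's recursive `sahiE` by unfolding the recursion
(the cases `n ≤ 4` are `sahiE_one`–`sahiE_four` in `Functional.lean`; the general `n` is
`sahiE_eq_sahiESetPartition`). [cite: Sahi2008, p. 213 (display of E_3, E_4, E_5); Richards2004, eq. (1.9)] -/
theorem sahiE_five (μ : α → ℝ) (a b c d e : α → ℝ) :
    sahiE μ 5 ![a, b, c, d, e] =
      24 * ex μ (a * b * c * d * e)
      - 6 * (ex μ (b * c * d * e) * ex μ a + ex μ (a * c * d * e) * ex μ b + ex μ (a * b * d * e) * ex μ c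
             + ex μ (a * b * c * e) * ex μ d + ex μ (a * b * c * d) * ex μ e)
      - 2 * (ex μ (a * b * c) * ex μ (d * e) + ex μ (a * b * d) * ex μ (c * e) + ex μ (a * b * e) * ex μ (c * d)
             + ex μ (a * c * d) * ex μ (b * e) + ex μ (a * c * e) * ex μ (b * d) + ex μ (a * d * e) * ex μ (b * c)
             + ex μ (b * c * d) * ex μ (a * e) + ex μ (b * c * e) * ex μ (a * d) + ex μ (b * d * e) * ex μ (a * c)
             + ex μ (c * d * e) * ex μ (a * b))
      + 2 * (ex μ (a * b * c) * ex μ d * ex μ e + ex μ (a * b * d) * ex μ c * ex μ e + ex μ (a * b * e) * ex μ c * ex μ d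
             + ex μ (a * c * d) * ex μ b * ex μ e + ex μ (a * c * e) * ex μ b * ex μ d + ex μ (a * d * e) * ex μ b * ex μ c
             + ex μ (b * c * d) * ex μ a * ex μ e + ex μ (b * c * e) * ex μ a * ex μ d + ex μ (b * d * e) * ex μ a * ex μ c
             + ex μ (c * d * e) * ex μ a * ex μ b)
      + (ex μ (a * b) * ex μ (c * d) * ex μ e + ex μ (a * b) * ex μ (c * e) * ex μ d + ex μ (a * b) * ex μ (d * e) * ex μ c
         + ex μ (a * c) * ex μ (b * d) * ex μ e + ex μ (a * c) * ex μ (b * e) * ex μ d + ex μ (a * c) * ex μ (d * e) * ex μ b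
         + ex μ (a * d) * ex μ (b * c) * ex μ e + ex μ (a * d) * ex μ (b * e) * ex μ c + ex μ (a * d) * ex μ (c * e) * ex μ b
         + ex μ (a * e) * ex μ (b * c) * ex μ d + ex μ (a * e) * ex μ (b * d) * ex μ c + ex μ (a * e) * ex μ (c * d) * ex μ b
         + ex μ (b * c) * ex μ (d * e) * ex μ a + ex μ (b * d) * ex μ (c * e) * ex μ a + ex μ (b * e) * ex μ (c * d) * ex μ a)
      - (ex μ (a * b) * ex μ c * ex μ d * ex μ e + ex μ (a * c) * ex μ b * ex μ d * ex μ e + ex μ (a * d) * ex μ b * ex μ c * ex μ e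
         + ex μ (a * e) * ex μ b * ex μ c * ex μ d + ex μ (b * c) * ex μ a * ex μ d * ex μ e + ex μ (b * d) * ex μ a * ex μ c * ex μ e
         + ex μ (b * e) * ex μ a * ex μ c * ex μ d + ex μ (c * d) * ex μ a * ex μ b * ex μ e + ex μ (c * e) * ex μ a * ex μ b * ex μ d
         + ex μ (d * e) * ex μ a * ex μ b * ex μ c)
      + ex μ a * ex μ b * ex μ c * ex μ d * ex μ e := by
  simp only [sahiE, Nat.reduceAdd, univ_unique, Fin.default_eq_zero, Fin.isValue, Function.update, Fin.tail,
    Matrix.cons_val_succ, Matrix.cons_val_zero, eq_rec_constant, dite_eq_ite, Fin.succ_zero_eq_one,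
    Matrix.cons_val_one, mul_ite, ite_mul, Matrix.cons_val_fin_one, Fin.succ_one_eq_two, Matrix.cons_val,
    Fin.reduceSucc, sum_singleton, reduceIte, sum_sub_distrib, Fin.sum_univ_succ, one_ne_zero, zero_ne_one,
    Fin.reduceEq]
  ring_nf

end Literature.Combinatorics.Sahi2008
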